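import Summits.BirchSwinnertonDyer.BirchSwinnertonDyer.Theorems.ClassRecordThreeExceptionalZeroRoadPinningDichotomy
import Literature.NumberTheory.EllipticCurves.SteinWuthrich2013.SplitMultCanonicalHolds
import HarnessLib

/-!
# The (4.1)-pinned height EXISTS at a split multiplicative prime (non-vacuity of the pinning dichotomy)

Cell `bsd-stepL`, seat `bsd-stepL-mult-p4` g5; companion of
`Theorems/ClassRecordThreeExceptionalZeroRoadPinningDichotomy.lean` (p564360). The tree's existence facts
for the Stein–Wuthrich §4.2 pinnings are `exists_isSplitMultCanonical` (split prime, PROVED: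
`exists_isSplitMultCanonical_holds`) and `exists_isMultCanonical` (formula (4.1)) — the latter stated and
proved ONLY at a NON-split prime. At a SPLIT prime the left disjunct of
`Dichotomy.regulatorNonvanishingAt_left_or_right_of_rank_one` («Schneider for every (4.1)-pinned datum at
the Tate parameter») would be VACUOUS if no (4.1)-pinned datum existed there. This file closes that gap
(theorems only; 0 def ∕ fact ∕ sorry):

* `padicLog_toPadicPoint_eq_of_isAdmissible` — on an admissible rational point the `ℤ_p`-linear
  logarithm of `E(ℚ_p)` is the formal-group logarithm `log_E(z(P))`;
* **`exists_isMultCanonical_of_split`** — for `p ≠ 2` and a Tate datum `Dq` there IS a (symmetric,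
  bilinear, torsion-vanishing) datum pinned by formula (4.1) at `q = q_E`: namely
  `⟨P,Q⟩₍₄.₁₎ := ⟨P,Q⟩_{§4.2} + log_ω(P)·log_ω(Q)/(C²·log_p q_E)`, `log_ω` the `ℤ_p`-linear logarithm
  (`Additive.LocalLog.padicLog`) pulled back to `E(ℚ)` — a genuine bilinear form because `log_ω` is
  additive; its quadratic form on admissible points is `heightSplit + log_E(z P)²/(C² log_p q_E) =
  heightFourOne` (`Dichotomy.heightFourOne_sub_heightSplit`);
* `existsUnique_isMultCanonical_of_split` — and it is unique (`IsMultCanonical.unique`);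
* **`exists_pinnings_schneider_or_of_rank_one`** — the NON-VACUOUS dichotomy: at a split prime `p ≠ 2`,
  in rank one, there EXIST the two pinned data `Dh₁` ((4.1)) and `Dh₂` (§4.2), and
  `SchneiderConjecture Dh₁ ∨ SchneiderConjecture Dh₂`.

Nothing about `Ш`; T7 — closes nothing. [cite: SteinWuthrich2013, §4.2 (pp. 15–16)]
-/

set_option linter.dupNamespace false
set_option autoImplicit false

noncomputable section

open scoped Classical

namespace Summit.BirchSwinnertonDyer.BirchSwinnertonDyer.Theorems.ExceptionalZeroRoad.Dichotomy

open WeierstrassCurve Literature.NumberTheory.EllipticCurves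
  Literature.NumberTheory.EllipticCurves.SteinWuthrich2013
  Summit.BirchSwinnertonDyer.Rank1Residual

variable {W : WeierstrassCurve ℚ} {p : ℕ} [Fact p.Prime]

/-- **On an admissible rational point `P = (x, y)` the `ℤ_p`-linear logarithm of `E(ℚ_p)` is
`log_E(z(P)) = log_E(-x/y)`** (`padicLog = log_W(z(N·P))/N` and `log_W ∘ z` is additive on `E₁(ℚ_p)`).
[cite: SilvermanAEC2009, IV.6.4 and VII.2.2] -/
theorem padicLog_toPadicPoint_eq_of_isAdmissible [W.IsElliptic] [W.IsGloballyMinimal]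
    {x y : ℚ} {h : W.toAffine.Nonsingular x y} (hP : W.IsAdmissible p (.some x y h)) :
    Additive.LocalLog.padicLog (W.baseChange ℚ_[p]) (W.toPadicPoint p (.some x y h)) =
      (W.baseChange ℚ_[p]).padicFormalLog (-(x : ℚ_[p]) / y) := by
  set X : WeierstrassCurve ℚ_[p] := W.baseChange ℚ_[p] with hX
  have hPp' : W.toPadicPoint p (.some x y h) = .some (x : ℚ_[p]) (y : ℚ_[p]) (nonsingular_ratCast h) :=
    toPadicPoint_some h
  have hker : X.IsInReductionKernel (W.toPadicPoint p (.some x y h)) := by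
    rw [hPp']; exact hP.2.1
  have hN : ((X.formalFiltration 2).index : ℚ_[p]) ≠ 0 :=
    Nat.cast_ne_zero.mpr (Additive.LocalLog.index_formalFiltration_two_ne_zero X)
  rw [Additive.LocalLog.padicLog_eq_padicLogPoint_nsmul_div,
    Additive.LocalLog.padicLogPoint_nsmul X hker, mul_div_cancel_left₀ _ hN, hPp']
  rfl

/-- **A (4.1)-pinned datum EXISTS at a split multiplicative prime `p ≠ 2`.** Construction: take THE
§4.2 split datum `Dh₂` (`exists_isSplitMultCanonical_holds`) and add the rank-one symmetric bilinear
form `(P, Q) ↦ log_ω(P)·log_ω(Q)/(C²·log_p q_E)` (`log_ω` = `Additive.LocalLog.padicLog` on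
`E(ℚ_p)` pulled back along `E(ℚ) → E(ℚ_p)`; additive and zero on torsion); on admissible points its
quadratic form is `heightSplit + log_E(z P)²/(C²·log_p q_E) = heightFourOne`
(`heightFourOne_sub_heightSplit`). [cite: SteinWuthrich2013, §4.2 (pp. 15–16)] -/
theorem exists_isMultCanonical_of_split [W.IsElliptic] [W.IsGloballyMinimal] (hp : p ≠ 2)
    (Dq : TateParameterData W p) : ∃ Dh : PAdicHeightData W p, IsMultCanonical Dh Dq.q := by
  obtain ⟨Dh₂, h₂⟩ := exists_isSplitMultCanonical_holds W p hp Dq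
  set X : WeierstrassCurve ℚ_[p] := W.baseChange ℚ_[p] with hX
  -- the ℤ-linear logarithm on E(ℚ)
  set L : W.toAffine.Point →+ ℚ_[p] :=
    (Additive.LocalLog.padicLog X).comp (W.toPadicPoint p) with hL
  set c : ℚ_[p] := (uniformisationScaleSq W p Dq.q * padicLog p Dq.q)⁻¹ with hc
  -- the rank-one bilinear form `c · L(P) · L(Q)`
  set B : W.toAffine.Point →+ W.toAffine.Point →+ ℚ_[p] :=
    ((AddMonoidHom.mul.comp L).compl₂ L).compr₂ (AddMonoidHom.mulLeft c) with hB
  have hBapply : ∀ P Q, B P Q = c * (L P * L Q) := fun P Q => rfl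
  have hLtors : ∀ P : W.toAffine.Point, IsOfFinAddOrder P → L P = 0 := by
    intro P hP
    have hPp : IsOfFinAddOrder (W.toPadicPoint p P) := (W.toPadicPoint p).isOfFinAddOrder hP
    show Additive.LocalLog.padicLog X (W.toPadicPoint p P) = 0
    exact (Additive.LocalLog.padicLog_eq_zero_iff X _).mpr hPp
  refine ⟨{ pairing := Dh₂.pairing + B
            symm := fun P Q => ?_
            map_torsion := fun P Q hP => ?_ }, ?_⟩
  · show Dh₂.pairing P Q + B P Q = Dh₂.pairing Q P + B Q P
    rw [Dh₂.symm P Q, hBapply, hBapply, mul_comm (L P) (L Q)]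
  · show Dh₂.pairing P Q + B P Q = 0
    rw [Dh₂.map_torsion P Q hP, hBapply, hLtors P hP, zero_mul, mul_zero, add_zero]
  · intro P hP
    rcases P with _ | ⟨x, y, h⟩
    · exact absurd hP.2 id
    · show Dh₂.pairing _ _ + B _ _ = _
      rw [h₂ _ hP, hBapply]
      have e := heightFourOne_sub_heightSplit Dq h
      have hLP : L (.some x y h) = X.padicFormalLog (-(x : ℚ_[p]) / y) :=
        padicLog_toPadicPoint_eq_of_isAdmissible hP
      rw [hLP, hc]
      rw [logUnitParamSq, ← hX] at e
      linear_combination -e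

/-- **… and it is unique** (two (4.1)-pinned data coincide: `IsMultCanonical.unique`).
[cite: SteinWuthrich2013, §4.2 (pp. 15–16)] -/
theorem existsUnique_isMultCanonical_of_split [W.IsElliptic] [W.IsGloballyMinimal] (hp : p ≠ 2)
    (Dq : TateParameterData W p) : ∃! Dh : PAdicHeightData W p, IsMultCanonical Dh Dq.q := by
  obtain ⟨Dh, hDh⟩ := exists_isMultCanonical_of_split hp Dq
  exact ⟨Dh, hDh, fun Dh' hDh' => IsMultCanonical.unique hDh' hDh⟩

/-- **The NON-VACUOUS pinning dichotomy.** For `E/ℚ` (globally minimal `W`) of Mordell–Weil rank one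
and `p ≠ 2` a prime of SPLIT multiplicative reduction (Tate datum `Dq`): there EXIST the (4.1)-pinned
datum `Dh₁` and the §4.2-pinned datum `Dh₂` (both unique), and `Reg_p(E,Dh₁) ≠ 0 ∨ Reg_p(E,Dh₂) ≠ 0`.
[cite: SteinWuthrich2013, §4.2 and Conj. 4.1] [cite: Schneider1982PadicHeightI, §1] -/
theorem exists_pinnings_schneider_or_of_rank_one [W.IsElliptic] [W.IsGloballyMinimal] (hp : p ≠ 2)
    (Dq : TateParameterData W p) (hr : W.mordellWeilRank = 1) :
    ∃ Dh₁ Dh₂ : PAdicHeightData W p, IsMultCanonical Dh₁ Dq.q ∧ IsSplitMultCanonical Dh₂ Dq ∧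
      (SchneiderConjecture Dh₁ ∨ SchneiderConjecture Dh₂) := by
  obtain ⟨Dh₁, h₁⟩ := exists_isMultCanonical_of_split hp Dq
  obtain ⟨Dh₂, h₂⟩ := exists_isSplitMultCanonical_holds W p hp Dq
  exact ⟨Dh₁, Dh₂, h₁, h₂, schneiderConjecture_or_of_rank_one Dq h₁ h₂ hr⟩

end Summit.BirchSwinnertonDyer.BirchSwinnertonDyer.Theorems.ExceptionalZeroRoad.Dichotomy

end
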